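import Summits.QuantumFields.YangMills.Theorems.BalabanUVNodesN14AtTopBornTower
import Summits.QuantumFields.YangMills.Theorems.BalabanUVNodesN14DressedTowerGuard

/-!
# DAG node N14 · NE1′ — THE UNIT-SCALE (TOP-BORN) TOWER OF RECORD AGAINST THE NONDEGENERACY GUARD OF RECORD: `Nondegenerate`, the rate clause
# `RateCovers … 1`, the keyed `Ne1NondegenerateOn` at every regime, ROOT-B, and the failure of the per-scale variant

Cell `pub-ymgap`, YM-PLAN Track A (HUMAN RULING D-0062 ∕ D-0149), width seat `pub-ymgap-dag-n14-w1` (generation 0), FILE 2 — the guard lemmas plan g78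
asked for with the record name (W-SEAT-START-LIST v4 §2 n14 row, «on LANDED post the record NAME of the tower + the guard lemma names»): the K3⁷ v2 skeleton
pins `ne1 :=` THIS seat's `YMDAG.N14.TopBorn.ne1UnitScale l₀ M Λ` (FILE 1 `BalabanUVNodesN14AtTopBornTower`, director-ym №195 (8) reading (a)) and conjoins
dag-n14-w2's guard `YMDAG.N14.TowerGuard.Nondegenerate` (`BalabanUVNodesN14DressedTowerGuard`, p584216: `Nonempty c.P ∧ BirthsNonempty c.𝒯 ∧ NotVacuum c.𝒯`).
THEOREMS ONLY (0 `def`, 0 `sorry`, standard axioms); imports FILE 1 + p584216 ONLY; modifies nothing; `--supports` K3⁷ `SpineGivenEndpointR13SepCoPH`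
(stmt-QuantumFields-20544) `--as helper` — COUNT-NEUTRAL.

* `not_memberPerScale_of_topBorn` [decided] — a top-born tower over an inhabited index FAILS w2's STRONGER variant `MemberPerScale` (cutoff `1` has no member
  of scale `0`); `not_nondegeneratePerScale_ne1UnitScale`.
* `birthsNonempty_sourceTower`, `notVacuum_sourceTower` (`0 < l₀`, `0 < M`: the insertion at the source `t = l₀`, cutoff `0`, books `l₀·M > 0`),
  **`nondegenerate_ne1UnitScale`** — THE PIN OF RECORD PASSES THE GUARD OF RECORD at every `(F, θ, hP, g₀, os)`; `nondegenerate_ne1UnitScale_iff` — IFF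
  `0 < l₀ ∧ 0 < M` (the letters have content).
* `rateCovers_sourceTower` ∕ `rateCovers_ne1UnitScale` — w2's rate clause at multiplicity `N₀ = 1` for every `Λ ≥ 0` (one insertion felt at the one
  unit-lattice cube); `dressedBudget_sourceTower` — ROOT-B on the source tower (w2's `dressedBudget_of_n14At_rateCovers` by name).
* **`ne1NondegenerateOn_readingUnitScale`** (the keyed guard at EVERY regime and every `lit`) and **`guard_and_s_N14_readingUnitScale`** — guard ∧ rate clause ∧
  `S_N14 (RRec₁₃CoPHOn (readingUnitScale lit l₀ M Λ) Rg)` JOINTLY (A6 hygiene for the guarded N14 slot of K3⁷ v2: `0 < l₀`, `0 < M`, `0 ≤ Λ`).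

HONEST FRAMING.  Count-neutral decided facts about a model tower and by-name bookkeeping; a guard EXCLUDES junk (the empty ∕ birthless ∕ vacuum towers), it
does not tie `ne1` to Bałaban's run — reading (a) is the director's adopted table reading; nothing of Bałaban's is asserted; NE1′ NOT PRINTED ∕ NOT PROVED;
N14 NOT discharged; K3⁷ OPEN, not claimed; counts unmoved (typed 28∕28 · discharged 5∕27, A 5∕28).  The Yang–Mills mass gap (Clay) is NOT proved by any
of this — R4 closes the conditional finite-𝕋⁴ rung `BalabanLadder.UV` only; NOT ℝ⁴, NOT OS, NOT a mass gap.
-/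

noncomputable section

namespace YMDAG.N14.TopBorn

open Finset
open scoped BigOperators
open Literature.MathematicalPhysics.QuantumFieldTheory.Balaban1983to89
open Literature.MathematicalPhysics.QuantumFieldTheory.Balaban1983to89.T4Continuum
open Literature.MathematicalPhysics.QuantumFieldTheory.Balaban1983to89.T4TermFormat
open Summit.QuantumFields.BalabanUV.T4Continuum.NE1p.DressedRoot
open YMDAG.UVSplit
open Node00 (Stage13HParams RateObjects₁₁)

/-! ## The unit-scale tower against dag-n14-w2's guard of record (`YMDAG.N14.TowerGuard`, p584216) -/

section Guard

open YMDAG.N14.TowerGuard (BirthsNonempty MemberPerScale NotVacuum Nondegenerate NondegeneratePerScale RateCovers Ne1NondegenerateOn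
  dressedBudget_of_n14At_rateCovers)

variable {N : ℕ} [NeZero N]

/-- **A TOP-BORN TOWER OVER AN INHABITED INDEX FAILS THE PER-SCALE CLAUSE** [decided]: at cutoff `1` no booked member has scale `0`
(`MemberPerScale` is dag-n14-w2's STRONGER variant — defined and tested, NOT the guard of record). [folklore] -/
theorem not_memberPerScale_of_topBorn {P : Type*} {𝒯 : DressedTower P} [Nonempty P] (htop : TowerTopBorn 𝒯) :
    ¬ MemberPerScale 𝒯 := by
  intro h
  obtain ⟨p⟩ := ‹Nonempty P›
  obtain ⟨b, hb⟩ := h p 1 0 (Nat.zero_le 1)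
  have h1 : (𝒯.B p 1).birthScale b = (𝒯.B p 1).K := htop p 1 b
  rw [𝒯.K_eq p 1, hb] at h1
  exact Nat.zero_ne_one h1

variable {l₀ M Λ : ℝ}

/-- Every booking of the source tower has its member (the one insertion). [folklore] -/
theorem birthsNonempty_sourceTower (hM : 0 ≤ M) : BirthsNonempty (sourceTower l₀ M hM) :=
  fun t K => nonempty_birth_sourceTower hM t K

/-- **THE SOURCE TOWER IS NOT THE VACUUM** for a positive window and a positive observable bound [decided]: at the source `t = l₀`, cutoff `0`,
the insertion books size `l₀·M > 0`. [folklore] -/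
theorem notVacuum_sourceTower (hl₀ : 0 < l₀) (hM : 0 < M) : NotVacuum (sourceTower l₀ M hM.le) :=
  ⟨⟨l₀, by rw [abs_of_pos hl₀]⟩, 0, (), 0, le_rfl, le_rfl, size_pos_sourceTower hM _ hl₀.ne' 0 () 0⟩

/-- **THE UNIT-SCALE ASSIGNMENT PASSES THE GUARD OF RECORD** [decided]: `Nondegenerate (ne1UnitScale l₀ M Λ …)` at EVERY `(F, θ, hP, g₀, os)` for
`0 < l₀`, `0 < M` — index inhabited (source `0`), every booking has its member, not the vacuum. [folklore] -/
theorem nondegenerate_ne1UnitScale (hl₀ : 0 < l₀) (hM : 0 < M) (Λ : ℝ) (F : T4Family) (θ : Stage13HParams F N) (hP : θ.Provisos₁₃CoPH F N)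
    (g₀ : ℕ → ℝ) (os : List (ULoop F)) : Nondegenerate (ne1UnitScale (N := N) l₀ M Λ hM.le F θ hP g₀ os) :=
  ⟨nonempty_sourceWindow hl₀.le, birthsNonempty_sourceTower hM.le, notVacuum_sourceTower hl₀ hM⟩

/-- **THE LETTERS HAVE CONTENT** [decided]: the unit-scale assignment passes the guard of record IFF the source window and the observable bound are
POSITIVE — `Nondegenerate (ne1UnitScale l₀ M Λ …) ↔ 0 < l₀ ∧ 0 < M` (at `M = 0` or `l₀ = 0` every booked size `|t|·M` vanishes: the vacuum; at `l₀ < 0` the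
index is empty). [folklore] -/
theorem nondegenerate_ne1UnitScale_iff (hM : 0 ≤ M) (Λ : ℝ) (F : T4Family) (θ : Stage13HParams F N) (hP : θ.Provisos₁₃CoPH F N) (g₀ : ℕ → ℝ)
    (os : List (ULoop F)) : Nondegenerate (ne1UnitScale (N := N) l₀ M Λ hM F θ hP g₀ os) ↔ 0 < l₀ ∧ 0 < M := by
  constructor
  · rintro ⟨-, -, t, K, b, k, -, -, hpos⟩
    have hpos' : 0 < |t.1| * M := hpos
    rcases pos_and_pos_or_neg_and_neg_of_mul_pos hpos' with ⟨ht, hMpos⟩ | ⟨ht, -⟩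
    · exact ⟨ht.trans_le t.2, hMpos⟩
    · exact absurd ht (not_lt.mpr (abs_nonneg t.1))
  · rintro ⟨hl₀, hMpos⟩
    exact nondegenerate_ne1UnitScale hl₀ hMpos Λ F θ hP g₀ os

/-- … and FAILS the per-scale variant (top-born; `not_memberPerScale_of_topBorn`). [folklore] -/
theorem not_nondegeneratePerScale_ne1UnitScale (hl₀ : 0 ≤ l₀) (hM : 0 ≤ M) (Λ : ℝ) (F : T4Family) (θ : Stage13HParams F N)
    (hP : θ.Provisos₁₃CoPH F N) (g₀ : ℕ → ℝ) (os : List (ULoop F)) :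
    ¬ NondegeneratePerScale (ne1UnitScale (N := N) l₀ M Λ hM F θ hP g₀ os) := fun h =>
  haveI : Nonempty (ne1UnitScale (N := N) l₀ M Λ hM F θ hP g₀ os).P := nonempty_sourceWindow hl₀
  not_memberPerScale_of_topBorn (towerTopBorn_unitScaleTower Unit _ _) h.2.1

/-- **THE RATE CLAUSE AT MULTIPLICITY `1`** [decided]: the one insertion is felt at the one unit-lattice cube, so the bookings' positional counts are
covered by `1·Λ^{k−j}` for every `Λ ≥ 0` (`RateCovers ⟨_, sourceTower l₀ M, Λ⟩ 1`). [folklore] -/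
theorem rateCovers_sourceTower (hM : 0 ≤ M) (hΛ : 0 ≤ Λ) : RateCovers ⟨{t : ℝ // |t| ≤ l₀}, sourceTower l₀ M hM, Λ⟩ 1 := by
  refine ⟨zero_le_one, fun t K q j => ?_⟩
  show (((Finset.univ : Finset Unit).filter fun _ => K = j).card : ℝ) ≤ 1 * Λ ^ (K - j)
  by_cases hj : K = j
  · subst hj
    simp
  · rw [Finset.filter_eq_empty_iff.mpr fun _ _ => hj, Finset.card_empty, Nat.cast_zero, one_mul]
    exact pow_nonneg hΛ _

/-- The rate clause for the unit-scale assignment at every tuple. [folklore] -/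
theorem rateCovers_ne1UnitScale (hM : 0 ≤ M) (hΛ : 0 ≤ Λ) (F : T4Family) (θ : Stage13HParams F N) (hP : θ.Provisos₁₃CoPH F N) (g₀ : ℕ → ℝ)
    (os : List (ULoop F)) : RateCovers (ne1UnitScale (N := N) l₀ M Λ hM F θ hP g₀ os) 1 :=
  rateCovers_sourceTower hM hΛ

/-- **ROOT-B ON THE SOURCE TOWER** [bookkeeping]: `N14At` + the rate clause give `DressedBudget` for every run-weight profile in `[0, w̄]` (dag-n14-w2's
`dressedBudget_of_n14At_rateCovers`, owner's `dressedBudget_of_dressedStabilityStrict` by name). [folklore] -/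
theorem dressedBudget_sourceTower (hl₀ : 0 ≤ l₀) (hM : 0 ≤ M) (hΛ : 0 ≤ Λ) {wbar : ℝ} {w : {t : ℝ // |t| ≤ l₀} → ℕ → ℕ → ℝ} (hwbar : 0 ≤ wbar)
    (hw0 : ∀ p K, ∀ j ≤ K, 0 ≤ w p K j) (hwb : ∀ p K, ∀ j ≤ K, w p K j ≤ wbar) : DressedBudget (sourceTower l₀ M hM) w :=
  dressedBudget_of_n14At_rateCovers (c := ⟨_, sourceTower l₀ M hM, Λ⟩) (n14At_sourceTower hl₀ hM hΛ) (rateCovers_sourceTower hM hΛ) hwbar hw0 hwb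

variable (Rg : (F : T4Family) → Stage13HParams F N → Prop)
  (lit : (F : T4Family) → (θ : Stage13HParams F N) → θ.Provisos₁₃CoPH F N → (ℕ → ℝ) → List (ULoop F) → RateObjects₁₁ N)

/-- **THE KEYED GUARD OF RECORD HOLDS FOR THE UNIT-SCALE READING AT EVERY REGIME** [decided]: `Ne1NondegenerateOn (readingUnitScale lit l₀ M Λ) Rg`. [folklore] -/
theorem ne1NondegenerateOn_readingUnitScale (hl₀ : 0 < l₀) (hM : 0 < M) (Λ : ℝ) :
    Ne1NondegenerateOn (readingUnitScale lit l₀ M Λ hM.le) Rg :=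
  fun F θ hP _ _ g₀ os => nondegenerate_ne1UnitScale hl₀ hM Λ F θ hP g₀ os

/-- **GUARD ∧ RATE CLAUSE ∧ `S_N14` JOINTLY FOR THE UNIT-SCALE READING** [decided + bookkeeping] (A6 hygiene for the guarded slot of K3⁷ v2: the pin of
record passes the guard of record and closes N14's stub, at every regime and every `lit`; `0 < l₀`, `0 < M`, `0 ≤ Λ`). [folklore] -/
theorem guard_and_s_N14_readingUnitScale (hl₀ : 0 < l₀) (hM : 0 < M) (hΛ : 0 ≤ Λ) :
    Ne1NondegenerateOn (readingUnitScale lit l₀ M Λ hM.le) Rg ∧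
      (∀ (F : T4Family) (θ : Stage13HParams F N) (hP : θ.Provisos₁₃CoPH F N) (g₀ : ℕ → ℝ) (os : List (ULoop F)),
        RateCovers ((readingUnitScale lit l₀ M Λ hM.le).ne1 F θ hP g₀ os) 1) ∧
      S_N14 (RRec₁₃CoPHOn (readingUnitScale lit l₀ M Λ hM.le) Rg) :=
  ⟨ne1NondegenerateOn_readingUnitScale Rg lit hl₀ hM Λ, fun F θ hP g₀ os => rateCovers_ne1UnitScale hM.le hΛ F θ hP g₀ os,
    s_N14_readingUnitScale Rg lit hl₀.le hM.le hΛ⟩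

end Guard

end YMDAG.N14.TopBorn

end
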